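import Literature.AnabelianGeometry.EtaleTheta.TemperedFrobenioidCor38Sub

/-!
# [EtTh] Corollary 3.8 (ii) sub-DAG — row C38-L10 (derivation) PROVED: the induced equivalence of hulls

Mochizuki, *The étale theta function …*, Publ. RIMS **45** (2009), Cor. 3.8 (ii), proof PDF p.82 l.1–5: "Since
`Ψ` preserves base-field-theoretic pre-steps and base-field-theoretic morphisms, it follows from the explicit
description of the base-field-theoretic hull given in Remark 3.6.3 that `Ψ` preserves the [objects and morphisms
of the] subcategories `C₁^bs-fld ⊆ C₁`, `C₂^bs-fld ⊆ C₂`, hence induces an equivalence of categories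
`C₁^bs-fld ⥲ C₂^bs-fld`" [cite: MochizukiEtTh2009, Cor 3.8 p.82]. abc-iut cell, layer L2, seat abc-iut-w5-d124;
proof-only companion (0 definitions) of `TemperedFrobenioidCor38Sub.lean` (p413893/p414329, plan/L2/SUBDAG-EtTh-Cor38.md)
discharging its row **C38-L10 derivation**:
`Cor38Hyp.inducesHullEquivalence_of_rows : h.InducesHullEquivalenceOfRows` — from Rmk. 3.6.3 (isomorphism-full
hull + morphism clause `Remark363`; object clause `HullEssImageObjClause`) on both sides, faithful hulls, and the
rows C38-L02a (pre-steps), L06 (base-field-theoretic pre-steps), L08 (base-field-theoretic morphisms), L09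
(Frobenius-trivial objects), the functor `X ↦` (a chosen hull-preimage of `Ψ(hull₁ X)`), `g ↦` (the unique lift of
the conjugate of `Ψ(hull₁ g)`) is a faithful, full, essentially surjective functor `C₁^bs-fld ⥤ C₂^bs-fld` with
`hull₁ ⋙ Ψ ≅ it ⋙ hull₂` — an equivalence of the REAL hull categories (`TemperedFrobenioidHull.lean`).
Generic lemmas: essential-image morphisms of an isomorphism-full functor between image objects lift
(`exists_map_eq_of_essImageHom`, [EtTh] §0), zigzags transport along a relation-preserving map (`eqvGen_map`).
HONEST FRAMING: refereed pre-IUT material; nothing here bears on [IUTchIII] Cor. 3.12; typed ≠ proved elsewhere.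
-/

namespace Literature.AnabelianGeometry.EtaleTheta

open CategoryTheory Opposite Literature.AlgebraicGeometry.Frobenioids

universe u₀ v₀ u v w

variable {D₀ : Type u₀} [Category.{v₀} D₀] {V : FrdIMonoidStub.{w}}
  {T : RealifiedDivisorMonoids (D₀ := D₀) V} {D : Type u} [Category.{v} D] {VD : FrdICatStub.{u, v, w} D}

/-! ### Generic: essential-image morphisms of an isomorphism-full functor lift; zigzags transport -/

section Generic

variable {E : Type*} [Category E] {E' : Type*} [Category E']

/-- Morphisms of the essential image between objects `Φ X`, `Φ X'` of an isomorphism-full functor come from `Φ`: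
glue the abstract equivalence with the lifted isomorphisms ([EtTh] §0). [cite: MochizukiEtTh2009, §0 p.9] -/
theorem exists_map_eq_of_essImageHom {Φ : E ⥤ E'} (hΦ : IsIsomorphismFull Φ) {X X' : E}
    {f : Φ.obj X ⟶ Φ.obj X'} (hf : essImageHom Φ f) : ∃ g : X ⟶ X', Φ.map g = f := by
  obtain ⟨A, B, g', ⟨e⟩⟩ := hf
  let eA : Φ.obj A ≅ Φ.obj X := ⟨e.hom.left, e.inv.left, Arrow.hom_inv_id_left e, Arrow.inv_hom_id_left e⟩
  let eB : Φ.obj B ≅ Φ.obj X' :=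
    ⟨e.hom.right, e.inv.right, Arrow.hom_inv_id_right e, Arrow.inv_hom_id_right e⟩
  have w : eA.hom ≫ f = Φ.map g' ≫ eB.hom := Arrow.w e.hom
  obtain ⟨kA, hkA⟩ := hΦ.exists_mapIso_eq A X eA
  obtain ⟨kB, hkB⟩ := hΦ.exists_mapIso_eq B X' eB
  refine ⟨kA.inv ≫ g' ≫ kB.hom, ?_⟩
  have hA : Φ.map kA.inv = eA.inv := by rw [← Functor.mapIso_inv, hkA]
  have hB : Φ.map kB.hom = eB.hom := by rw [← Functor.mapIso_hom, hkB]
  rw [Functor.map_comp, Functor.map_comp, hA, hB, ← w, eA.inv_hom_id_assoc]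

/-- Essential-image morphisms are stable under abstract equivalence (isomorphism of arrows). [cite: MochizukiEtTh2009, §0 p.10] -/
theorem essImageHom_of_arrow_iso {Φ : E ⥤ E'} {W X Y Z : E'} {f : W ⟶ X} {g : Y ⟶ Z}
    (e : Arrow.mk f ≅ Arrow.mk g) (hf : essImageHom Φ f) : essImageHom Φ g := by
  obtain ⟨A, B, g', hg'⟩ := hf
  exact ⟨A, B, g', hg'.trans ⟨e⟩⟩

/-- Zigzags are carried along a map compatible with the generating relation. [folklore] -/
private theorem eqvGen_map {α β : Type*} {r : α → α → Prop} {s : β → β → Prop} (f : α → β)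
    (hf : ∀ a b, r a b → s (f a) (f b)) {a b : α} (hab : Relation.EqvGen r a b) :
    Relation.EqvGen s (f a) (f b) := by
  induction hab with
  | rel x y hxy => exact Relation.EqvGen.rel _ _ (hf _ _ hxy)
  | refl x => exact Relation.EqvGen.refl _
  | symm x y _ ih => exact Relation.EqvGen.symm _ _ ih
  | trans x y z _ _ ih₁ ih₂ => exact Relation.EqvGen.trans _ _ _ ih₁ ih₂

end Generic

namespace Cor38Hyp

variable {D₀' : Type u₀} [Category.{v₀} D₀'] {T' : RealifiedDivisorMonoids (D₀ := D₀') V}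
  {D' : Type u} [Category.{v} D'] {VD' : FrdICatStub.{u, v, w} D'}
  {C₁ : TemperedFrobenioid T D VD} {C₂ : TemperedFrobenioid T' D' VD'} (h : Cor38Hyp C₁ C₂)

/-- Objects of the essential image of `C₁^{bs-fld} → C₁` go to objects of the essential image of
`C₂^{bs-fld} → C₂` under `Ψ` (Rmk. 3.6.3 object clause on both sides + C38-L02a/L06/L09). [cite: MochizukiEtTh2009, Cor 3.8 p.82] -/
theorem essImageObj_map (hO₁ : C₁.HullEssImageObjClause) (hO₂ : C₂.HullEssImageObjClause)
    (hps : h.PreservesPreSteps) (hft : h.PreservesFrobeniusTrivial) (hbs : h.PreservesBsFldPreSteps)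
    {A : C₁.category} (hA : essImageObj C₁.hull A) : essImageObj C₂.hull (h.Ψ.functor.obj A) := by
  obtain ⟨A₀, hA₀, hlink⟩ := (hO₁ A).1 hA
  refine (hO₂ _).2 ⟨h.Ψ.functor.obj A₀, hft.1 hA₀, ?_⟩
  refine eqvGen_map (fun X => h.Ψ.functor.obj X) (fun X Y hXY => ?_) hlink
  obtain ⟨φ, hφ, hφb⟩ := hXY
  exact ⟨h.Ψ.functor.map φ, hps.1 φ hφ, (hbs.1 φ hφ).1 hφb⟩

/-- … and under `Ψ⁻¹` (Rmk. 3.6.3 object clause + C38-L02a/L06/L09, inverse directions). [cite: MochizukiEtTh2009, Cor 3.8 p.82] -/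
theorem essImageObj_inverse_map (hO₁ : C₁.HullEssImageObjClause) (hO₂ : C₂.HullEssImageObjClause)
    (hps : h.PreservesPreSteps) (hft : h.PreservesFrobeniusTrivial) (hbs : h.PreservesBsFldPreSteps)
    {B : C₂.category} (hB : essImageObj C₂.hull B) : essImageObj C₁.hull (h.Ψ.inverse.obj B) := by
  obtain ⟨B₀, hB₀, hlink⟩ := (hO₂ B).1 hB
  refine (hO₁ _).2 ⟨h.Ψ.inverse.obj B₀, hft.2 hB₀, ?_⟩
  refine eqvGen_map (fun X => h.Ψ.inverse.obj X) (fun X Y hXY => ?_) hlink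
  obtain ⟨φ, hφ, hφb⟩ := hXY
  exact ⟨h.Ψ.inverse.map φ, hps.2 φ hφ, (hbs.2 φ hφ).1 hφb⟩

/-- The base-field-theoretic morphisms between essential-image objects are the essential-image morphisms
(Rmk. 3.6.3, morphism clause) — hence stable under isomorphism of arrows between essential-image objects.
[cite: MochizukiEtTh2009, Rmk 3.6.3 p.79] -/
theorem isBaseFieldTheoretic_of_arrow_iso (hR : C₂.Remark363) {W X Y Z : C₂.category} {f : W ⟶ X}
    {g : Y ⟶ Z} (e : Arrow.mk f ≅ Arrow.mk g) (hW : essImageObj C₂.hull W) (hX : essImageObj C₂.hull X)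
    (hY : essImageObj C₂.hull Y) (hZ : essImageObj C₂.hull Z) (hf : C₂.IsBaseFieldTheoretic f) :
    C₂.IsBaseFieldTheoretic g :=
  (hR.2 g hY hZ).1 (essImageHom_of_arrow_iso e ((hR.2 f hW hX).2 hf))

/-- **C38-L10 derivation PROVED** (p.82 l.1–5): from Rmk. 3.6.3 (both clauses, both sides), the faithful hulls, and
C38-L02a/L06/L08/L09, the equivalence `Ψ` induces a compatible equivalence `C₁^{bs-fld} ⥲ C₂^{bs-fld}` of the
REAL hull categories. [cite: MochizukiEtTh2009, Cor 3.8 p.82] -/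
theorem inducesHullEquivalence_of_rows : h.InducesHullEquivalenceOfRows := by
  intro hR₁ hR₂ hO₁ hO₂ hF₁ hF₂ hps hft hbs hbft
  haveI : C₁.hull.Faithful := hF₁
  haveI : C₂.hull.Faithful := hF₂
  -- objects: choose preimages in `C₂^{bs-fld}` of `Ψ(hull₁ X)`
  have hY : ∀ X : C₁.hullCategory, essImageObj C₂.hull (h.Ψ.functor.obj (C₁.hull.obj X)) := fun X =>
    h.essImageObj_map hO₁ hO₂ hps hft hbs (Functor.obj_mem_essImage _ _)
  let Y : C₁.hullCategory → C₂.hullCategory := fun X => Functor.essImage.witness (hY X)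
  let ι : ∀ X, C₂.hull.obj (Y X) ≅ h.Ψ.functor.obj (C₁.hull.obj X) := fun X =>
    Functor.essImage.getIso (hY X)
  -- morphisms: the conjugate of `Ψ(hull₁ g)` lies in the essential image of `hull₂`, hence lifts
  have hlift : ∀ {X X' : C₁.hullCategory} (g : X ⟶ X'), ∃ g₂ : Y X ⟶ Y X',
      C₂.hull.map g₂ = (ι X).hom ≫ h.Ψ.functor.map (C₁.hull.map g) ≫ (ι X').inv := by
    intro X X' g
    apply exists_map_eq_of_essImageHom hR₂.1
    have h1 : C₁.IsBaseFieldTheoretic (C₁.hull.map g) :=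
      (hR₁.2 _ (Functor.obj_mem_essImage _ _) (Functor.obj_mem_essImage _ _)).1 (essImageHom_map _ g)
    have h2 : C₂.IsBaseFieldTheoretic (h.Ψ.functor.map (C₁.hull.map g)) := (hbft _).1 h1
    have h3 : essImageHom C₂.hull (h.Ψ.functor.map (C₁.hull.map g)) := (hR₂.2 _ (hY X) (hY X')).2 h2
    refine essImageHom_of_arrow_iso (Arrow.isoMk' _ _ (ι X).symm (ι X').symm ?_) h3
    simp
  choose Φm hΦm using @hlift
  -- the functor
  let G : C₁.hullCategory ⥤ C₂.hullCategory :=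
    { obj := Y
      map := fun g => Φm g
      map_id := fun X => C₂.hull.map_injective (by rw [hΦm]; simp)
      map_comp := fun f g => C₂.hull.map_injective (by
        rw [hΦm, CategoryTheory.Functor.map_comp C₂.hull, hΦm, hΦm]; simp) }
  -- the natural isomorphism `hull₁ ⋙ Ψ ≅ G ⋙ hull₂`
  let e : C₁.hull ⋙ h.Ψ.functor ≅ G ⋙ C₂.hull :=
    NatIso.ofComponents (fun X => (ι X).symm) (fun {X X'} g => by
      change (h.Ψ.functor.map (C₁.hull.map g)) ≫ (ι X').inv = (ι X).inv ≫ C₂.hull.map (Φm g)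
      rw [hΦm]; simp)
  -- G is faithful
  have hGfaith : G.Faithful := ⟨fun {X X'} g g' hgg' => by
    have := congrArg (fun k => (ι X).inv ≫ C₂.hull.map k ≫ (ι X').hom) hgg'
    simp only [G, hΦm, Category.assoc, Iso.inv_hom_id, Category.comp_id, Iso.inv_hom_id_assoc] at this
    exact C₁.hull.map_injective (h.Ψ.functor.map_injective this)⟩
  -- G is full
  have hGfull : G.Full := ⟨fun {X X'} k => by
    let m₂ : h.Ψ.functor.obj (C₁.hull.obj X) ⟶ h.Ψ.functor.obj (C₁.hull.obj X') :=
      (ι X).inv ≫ C₂.hull.map k ≫ (ι X').hom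
    have hm₂ : C₂.IsBaseFieldTheoretic m₂ := by
      refine isBaseFieldTheoretic_of_arrow_iso hR₂ (Arrow.isoMk' (C₂.hull.map k) m₂ (ι X) (ι X') ?_)
        (Functor.obj_mem_essImage _ _) (Functor.obj_mem_essImage _ _) (hY X) (hY X') ?_
      · simp [m₂]
      · exact (hR₂.2 _ (Functor.obj_mem_essImage _ _) (Functor.obj_mem_essImage _ _)).1 (essImageHom_map _ k)
    let m : C₁.hull.obj X ⟶ C₁.hull.obj X' := h.Ψ.functor.preimage m₂
    have hm : C₁.IsBaseFieldTheoretic m := (hbft m).2 (by simpa [m] using hm₂)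
    obtain ⟨g, hg⟩ := exists_map_eq_of_essImageHom hR₁.1
      ((hR₁.2 m (Functor.obj_mem_essImage _ _) (Functor.obj_mem_essImage _ _)).2 hm)
    refine ⟨g, C₂.hull.map_injective ?_⟩
    change C₂.hull.map (Φm g) = C₂.hull.map k
    rw [hΦm, hg]
    simp [m, m₂]⟩
  -- G is essentially surjective
  have hGess : G.EssSurj := ⟨fun Z => by
    have hZ : essImageObj C₁.hull (h.Ψ.inverse.obj (C₂.hull.obj Z)) :=
      h.essImageObj_inverse_map hO₁ hO₂ hps hft hbs (Functor.obj_mem_essImage _ _)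
    let X : C₁.hullCategory := Functor.essImage.witness hZ
    let e₁ : C₁.hull.obj X ≅ h.Ψ.inverse.obj (C₂.hull.obj Z) := Functor.essImage.getIso hZ
    let e₂ : C₂.hull.obj (Y X) ≅ C₂.hull.obj Z :=
      ι X ≪≫ h.Ψ.functor.mapIso e₁ ≪≫ h.Ψ.counitIso.app (C₂.hull.obj Z)
    obtain ⟨k, -⟩ := hR₂.1.exists_mapIso_eq (Y X) Z e₂
    exact ⟨X, ⟨k⟩⟩⟩
  haveI : G.IsEquivalence := ⟨hGfaith, hGfull, hGess⟩
  exact ⟨G.asEquivalence, ⟨e⟩⟩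

end Cor38Hyp


end Literature.AnabelianGeometry.EtaleTheta
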